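import Summits.CriticalPhenomena.CardyFormulaZ2.Theses.CardySelfRefinement
import Literature.Probability.LatticeModels.ExplorationWinding
import Literature.Probability.LatticeModels.PolylinePrefix
import HarnessLib

/-!
# Exploration prefixes: groundwork for stub `stub_discreteLocality` of line `crosscut-dictionary`
for crux `LagHandOff` (stmt-CriticalPhenomena-10268)

Registered sub-goal stub `stub_discreteLocality_explorationPrefix` (namespace
`Summit.CriticalPhenomena.CardyFormulaZ2.Cruxes.LagHandOff.CrosscutDictionary`): the
DETERMINISTIC part of the exact lattice locality of G02's medial exploration (Smirnov 2001 §2,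
square-lattice version; tree files `MedialInterface.lean`, `MedialInterfaceProofs.lean`).
The exploration of the completed configuration `β = E.bcBondConfig ω` is the orbit
`cornerOrbit β c₀` of the deterministic successor map `nextCorner β` from the start corner `c₀`,
cut at its first corner with non-inner face; `nextCorner β p` reads ONE bit, the status of the
target edge `cTgt p`.  Hence, for two Dobrushin data `E₁, E₂` and configurations `ω₁, ω₂`:

* `cornerOrbit_eq_of_agree`: two orbits from the same corner agree up to step `k` as soon as
  the bits read at steps `n < k` agree;
* `medialExploration_take_eq`: if moreover `c₀` is a start corner of both (admissible) data and
  the faces met at steps `n < k` are inner in both, the explorations `medialExploration Eᵢ ωᵢ`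
  have at least `k + 1` medial vertices and the same first `k + 1` ones, the `k`-th being
  `cSrc (orb k)`;
* `medialExplorationCurve_eq_of_agree`: with equal meshes the exploration polylines then AGREE
  AS PARAMETRISED CURVES on `[0, 1 - 2^{-k}]` (dyadic `Path.trans` clock, tree file
  `PolylinePrefix.lean`) and sit at `medialPoint δ (cSrc (orb k))` at time `1 - 2^{-k}`;
* `exists_commonPrefix_bondInterfaceIn`: when the start midpoint is at least as close to `a` as
  to `b` for both marked domains (so that `orientCurve` reverses neither polyline) this is the
  disjunct `∃ c c' s, mk c = bondInterfaceIn D₁ E₁ ω₁ ∧ mk c' = bondInterfaceIn D₂ E₂ ω₂ ∧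
  (∀ t ≤ s, c t = c' t) ∧ c s = medialPoint δ (cSrc (orb k))` of the registered signature of
  `stub_discreteLocality` / `stub_discreteSplitting`;
* `medialExploration_eq_or_diverge`: FIRST DIVERGENCE — either the two explorations coincide,
  or there is a step `k` before which everything read agrees and at which either both faces are
  inner and the status of `cTgt (orb k)` differs, or exactly one of the two faces `cFace (orb k)`
  is inner; the prefix point `medialPoint δ (cSrc (orb k))` is within `δ / 2` of the vertex
  `(orb k).1`, a corner of that face and an endpoint of that edge (tree lemma
  `dist_medialPoint_cSrc_le`, `BoundaryValues.lean`).

What is NOT here (the rest of `stub_discreteLocality`, XL): the construction of COMPATIBLE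
admissible families for nested Dobrushin domains (same start corner, equal completed statuses and
inner faces away from `closure (D ∖ D')`), cf. `stub_discretisable`.
-/

noncomputable section

open MeasureTheory Filter Set Topology
open scoped BoundedContinuousFunction
open Literature.Probability.Percolation Literature.Probability.LatticeModels
open Literature.Probability.RandomPlanarGeometry Literature.Probability.Percolation.QuadCrossing
open Summit.CriticalPhenomena.CardyFormulaZ2.Theses.CardySelfRefinement

namespace Summit.CriticalPhenomena.CardyFormulaZ2.Cruxes.LagHandOff.CrosscutDictionary

/-! ### Orbits of the successor map reading the same bits agree -/

/-- **Orbit agreement.** The successor map `nextCorner β p` depends on `β` only through the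
status of the target edge `cTgt p`; hence two orbits from the same corner `c₀` in two completed
configurations `β₁`, `β₂` coincide up to step `k` as soon as, along the first orbit, the
statuses of the target edges read at the steps `n < k` agree. (Smirnov 2001, §2: the
exploration is determined by the edges it has examined.) -/
theorem cornerOrbit_eq_of_agree (β₁ β₂ : BondConfig (Site 2)) (c₀ : Site 2 × Fin 4) {k : ℕ}
    (h : ∀ n < k, (cTgt (cornerOrbit β₁ c₀ n) ∈ β₁ ↔ cTgt (cornerOrbit β₁ c₀ n) ∈ β₂)) :
    ∀ n ≤ k, cornerOrbit β₁ c₀ n = cornerOrbit β₂ c₀ n := by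
  intro n hn
  induction n with
  | zero => rfl
  | succ n ih =>
    have ih' := ih (Nat.le_of_succ_le hn)
    show nextCorner β₁ (cornerOrbit β₁ c₀ n) = nextCorner β₂ (cornerOrbit β₂ c₀ n)
    rw [← ih']
    by_cases hm : cTgt (cornerOrbit β₁ c₀ n) ∈ β₁
    · rw [nextCorner_of_mem hm, nextCorner_of_mem ((h n (Nat.lt_of_succ_le hn)).1 hm)]
    · rw [nextCorner_of_not_mem hm,
        nextCorner_of_not_mem fun h' => hm ((h n (Nat.lt_of_succ_le hn)).2 h')]

/-! ### The exploration as the cut orbit from any start corner -/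

/-- **The exploration is the cut orbit.** For admissible data and any start corner `c₀` (there
is exactly one, `existsUnique_startCorner`), the medial exploration of `ω` is
`explorationList (E.bcBondConfig ω) c₀ N` for the first index `N` at which the orbit meets a
non-inner face (existence and uniqueness of the exploration, `MedialInterfaceProofs`). -/
theorem exists_medialExploration_eq_explorationList {E : DiscreteDobrushin}
    (hE : E.IsZdAdmissible) {c₀ : Site 2 × Fin 4} (hc₀ : E.IsStartCorner c₀)
    (ω : BondConfig (Site 2)) :
    ∃ N, ¬ E.IsInnerFace (cFace (cornerOrbit (E.bcBondConfig ω) c₀ N)) ∧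
      (∀ n < N, E.IsInnerFace (cFace (cornerOrbit (E.bcBondConfig ω) c₀ n))) ∧
      medialExploration E ω = explorationList (E.bcBondConfig ω) c₀ N := by
  classical
  have hex := exists_not_isInnerFace_cornerOrbit (ω := ω) hE hc₀
  exact ⟨Nat.find hex, Nat.find_spec hex, fun n hn => not_not.1 (Nat.find_min hex hn),
    (isMedialExploration_medialExploration_holds E hE ω).eq_explorationList hE hc₀
      (Nat.find_spec hex) fun n hn => not_not.1 (Nat.find_min hex hn)⟩

/-- Two cut orbits of the same length whose orbits agree up to the cut are the same list. -/
theorem explorationList_eq_of_cornerOrbit_eq (β₁ β₂ : BondConfig (Site 2)) (c₁ c₂ : Site 2 × Fin 4)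
    {N : ℕ} (h : ∀ n ≤ N, cornerOrbit β₁ c₁ n = cornerOrbit β₂ c₂ n) :
    explorationList β₁ c₁ N = explorationList β₂ c₂ N := by
  unfold explorationList
  refine List.map_congr_left fun i hi => ?_
  rw [List.mem_range] at hi
  rw [h i (Nat.le_of_lt_succ hi)]

/-- **Common list prefix.** Let `E₁`, `E₂` be admissible Dobrushin data with a common start
corner `c₀`, and `ω₁`, `ω₂` two configurations.  If at every step `n < k` of the orbit of `c₀`
in `E₁.bcBondConfig ω₁` the status of the target edge is the same in `E₂.bcBondConfig ω₂` and
its face is inner for both data, then both explorations have more than `k` medial vertices,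
the same first `k + 1` of them, and the `k`-th one is the source edge of the `k`-th orbit
corner. (Smirnov 2001, §2.) -/
theorem medialExploration_take_eq {E₁ E₂ : DiscreteDobrushin} (hE₁ : E₁.IsZdAdmissible)
    (hE₂ : E₂.IsZdAdmissible) {c₀ : Site 2 × Fin 4} (hc₁ : E₁.IsStartCorner c₀)
    (hc₂ : E₂.IsStartCorner c₀) {ω₁ ω₂ : BondConfig (Site 2)} {k : ℕ}
    (hstat : ∀ n < k, (cTgt (cornerOrbit (E₁.bcBondConfig ω₁) c₀ n) ∈ E₁.bcBondConfig ω₁ ↔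
      cTgt (cornerOrbit (E₁.bcBondConfig ω₁) c₀ n) ∈ E₂.bcBondConfig ω₂))
    (hin₁ : ∀ n < k, E₁.IsInnerFace (cFace (cornerOrbit (E₁.bcBondConfig ω₁) c₀ n)))
    (hin₂ : ∀ n < k, E₂.IsInnerFace (cFace (cornerOrbit (E₁.bcBondConfig ω₁) c₀ n))) :
    k < (medialExploration E₁ ω₁).length ∧ k < (medialExploration E₂ ω₂).length ∧
      (medialExploration E₁ ω₁).take (k + 1) = (medialExploration E₂ ω₂).take (k + 1) ∧
      (medialExploration E₁ ω₁)[k]? = some (cSrc (cornerOrbit (E₁.bcBondConfig ω₁) c₀ k)) := by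
  have horb := cornerOrbit_eq_of_agree (E₁.bcBondConfig ω₁) (E₂.bcBondConfig ω₂) c₀ hstat
  obtain ⟨N₁, hN₁, hlt₁, heq₁⟩ := exists_medialExploration_eq_explorationList hE₁ hc₁ ω₁
  obtain ⟨N₂, hN₂, hlt₂, heq₂⟩ := exists_medialExploration_eq_explorationList hE₂ hc₂ ω₂
  have hk₁ : k ≤ N₁ := by
    by_contra hlt
    exact hN₁ (hin₁ N₁ (not_le.1 hlt))
  have hk₂ : k ≤ N₂ := by
    by_contra hlt
    have h := hin₂ N₂ (not_le.1 hlt)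
    rw [horb N₂ (not_le.1 hlt).le] at h
    exact hN₂ h
  have hlen₁ : (medialExploration E₁ ω₁).length = N₁ + 1 := by
    rw [heq₁]; simp [explorationList]
  have hlen₂ : (medialExploration E₂ ω₂).length = N₂ + 1 := by
    rw [heq₂]; simp [explorationList]
  have hget₁ : ∀ i (hi : i < (medialExploration E₁ ω₁).length),
      (medialExploration E₁ ω₁)[i] = cSrc (cornerOrbit (E₁.bcBondConfig ω₁) c₀ i) := by
    intro i hi
    simp [heq₁, explorationList]
  have hget₂ : ∀ i (hi : i < (medialExploration E₂ ω₂).length),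
      (medialExploration E₂ ω₂)[i] = cSrc (cornerOrbit (E₂.bcBondConfig ω₂) c₀ i) := by
    intro i hi
    simp [heq₂, explorationList]
  refine ⟨by omega, by omega, ?_, ?_⟩
  · apply List.ext_getElem
    · simp only [List.length_take]; omega
    · intro i h₁ h₂
      rw [List.length_take] at h₁ h₂
      rw [List.getElem_take, List.getElem_take, hget₁, hget₂, horb i (by omega)]
  · rw [List.getElem?_eq_getElem (by omega), hget₁]

/-! ### Parametrised agreement of the exploration polylines -/

section Polyline

variable {X : Type*} [AddCommGroup X] [Module ℝ X] [TopologicalSpace X] [ContinuousAdd X]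
  [ContinuousSMul ℝ X]

/-- **The `n`-th vertex is reached at the prefix time `1 - 2^{-n}`** (dyadic clock of the tree's
`polyline`, `PolylinePrefix.lean`): `polyline l (1 - 2^{-n}) = l[n]` for `n < l.length`.
(Camia–Newman 2007, §2: lattice paths as polygonal curves.) -/
theorem polyline_apply_prefixTime_eq_getElem {l : List X} {n : ℕ} (hn : n < l.length) :
    polyline l ⟨1 - (1 / 2) ^ n, one_sub_half_pow_mem_unitInterval n⟩ = l[n] := by
  set p := l.take (n + 1) with hp
  have hl : l = p ++ l.drop (n + 1) := (List.take_append_drop (n + 1) l).symm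
  have hplen : p.length = n + 1 := by
    rw [hp, List.length_take]
    omega
  obtain ⟨a, m, hpm⟩ : ∃ a m, p = a :: m := by
    cases hq : p with
    | nil => rw [hq] at hplen; simp at hplen
    | cons a m => exact ⟨a, m, rfl⟩
  have hm : m.length = n := by
    rw [hpm, List.length_cons] at hplen
    omega
  have hpn : p[n]'(by omega) = l[n] := by
    simp only [hp, List.getElem_take]
  have key := polyline_cons_append_apply_prefixTime a m (l.drop (n + 1))
  rw [hm, List.getLast_eq_getElem] at key
  have hidx : (a :: m)[(a :: m).length - 1]'(by simp) = p[n]'(by omega) := by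
    simp only [hpm, List.length_cons, hm, Nat.add_sub_cancel]
  rw [hidx, hpn] at key
  rw [← key]
  conv_lhs => rw [hl, hpm, List.cons_append]

end Polyline

/-- **The exploration polylines agree as parametrised curves up to the prefix time.** Under the
hypotheses of `medialExploration_take_eq` and with equal meshes, the two exploration polylines
coincide at every parameter `t ≤ 1 - 2^{-k}` and are at the midpoint of the source edge of the
`k`-th orbit corner at the parameter `1 - 2^{-k}`. (Smirnov 2001, §2; Camia–Newman 2007, §2.) -/
theorem medialExplorationCurve_eq_of_agree {E₁ E₂ : DiscreteDobrushin} (hE₁ : E₁.IsZdAdmissible)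
    (hE₂ : E₂.IsZdAdmissible) (hδ : E₁.δ = E₂.δ) {c₀ : Site 2 × Fin 4}
    (hc₁ : E₁.IsStartCorner c₀) (hc₂ : E₂.IsStartCorner c₀) {ω₁ ω₂ : BondConfig (Site 2)}
    {k : ℕ}
    (hstat : ∀ n < k, (cTgt (cornerOrbit (E₁.bcBondConfig ω₁) c₀ n) ∈ E₁.bcBondConfig ω₁ ↔
      cTgt (cornerOrbit (E₁.bcBondConfig ω₁) c₀ n) ∈ E₂.bcBondConfig ω₂))
    (hin₁ : ∀ n < k, E₁.IsInnerFace (cFace (cornerOrbit (E₁.bcBondConfig ω₁) c₀ n)))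
    (hin₂ : ∀ n < k, E₂.IsInnerFace (cFace (cornerOrbit (E₁.bcBondConfig ω₁) c₀ n))) :
    (∀ t : unitInterval, (t : ℝ) ≤ 1 - (1 / 2) ^ k →
        medialExplorationCurve E₁ ω₁ t = medialExplorationCurve E₂ ω₂ t) ∧
      medialExplorationCurve E₁ ω₁ ⟨1 - (1 / 2) ^ k, one_sub_half_pow_mem_unitInterval k⟩ =
        medialPoint E₁.δ (cSrc (cornerOrbit (E₁.bcBondConfig ω₁) c₀ k)) := by
  obtain ⟨hk₁, -, htake, hget⟩ := medialExploration_take_eq hE₁ hE₂ hc₁ hc₂ hstat hin₁ hin₂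
  have htake' : ((medialExploration E₁ ω₁).map (medialPoint E₁.δ)).take (k + 1) =
      ((medialExploration E₂ ω₂).map (medialPoint E₂.δ)).take (k + 1) := by
    rw [← List.map_take, ← List.map_take, htake, hδ]
  have hlen : k + 1 ≤ ((medialExploration E₁ ω₁).map (medialPoint E₁.δ)).length := by
    rw [List.length_map]; omega
  refine ⟨fun t ht => polyline_eqOn_of_take_eq htake' hlen ht, ?_⟩
  rw [medialExplorationCurve, polyline_apply_prefixTime_eq_getElem (by rw [List.length_map]; omega),
    List.getElem_map]
  congr 1
  exact (List.getElem_eq_iff (by omega)).2 hget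

/-- The exploration polyline of admissible data starts at the midpoint of the source edge `e_a`
of the start corner. -/
theorem medialExplorationCurve_apply_zero {E : DiscreteDobrushin} (hE : E.IsZdAdmissible)
    {c₀ : Site 2 × Fin 4} (hc₀ : E.IsStartCorner c₀) (ω : BondConfig (Site 2)) :
    medialExplorationCurve E ω 0 = medialPoint E.δ (cSrc c₀) := by
  obtain ⟨N, -, -, heq⟩ := exists_medialExploration_eq_explorationList hE hc₀ ω
  rw [medialExplorationCurve, heq, explorationList, List.range_succ_eq_map, List.map_cons,
    List.map_cons, polyline_apply_zero]
  rfl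

/-- **Plug-in form for the registered signatures of `stub_discreteLocality` /
`stub_discreteSplitting`.** Under the hypotheses of `medialExplorationCurve_eq_of_agree`, if for
both marked domains the common start midpoint `medialPoint δ e_a` is at least as close to `a` as
to `b` (so that the endpoint rule `orientCurve` keeps both polylines unreversed — true for all
fine meshes of a discretisation family, `eventually_forall_bondInterfaceIn_near` of the Chordal
file), the two interface classes have representatives agreeing on an initial parameter interval
`[0, s]` at the end of which they sit at `medialPoint δ (cSrc (orb k))`. -/
theorem exists_commonPrefix_bondInterfaceIn (D₁ D₂ : DobrushinDomain) {E₁ E₂ : DiscreteDobrushin}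
    (hE₁ : E₁.IsZdAdmissible) (hE₂ : E₂.IsZdAdmissible) (hδ : E₁.δ = E₂.δ)
    {c₀ : Site 2 × Fin 4} (hc₁ : E₁.IsStartCorner c₀) (hc₂ : E₂.IsStartCorner c₀)
    (ho₁ : dist (medialPoint E₁.δ (cSrc c₀)) (D₁.pt 0) ≤ dist (medialPoint E₁.δ (cSrc c₀)) (D₁.pt 1))
    (ho₂ : dist (medialPoint E₂.δ (cSrc c₀)) (D₂.pt 0) ≤ dist (medialPoint E₂.δ (cSrc c₀)) (D₂.pt 1))
    {ω₁ ω₂ : BondConfig (Site 2)} {k : ℕ}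
    (hstat : ∀ n < k, (cTgt (cornerOrbit (E₁.bcBondConfig ω₁) c₀ n) ∈ E₁.bcBondConfig ω₁ ↔
      cTgt (cornerOrbit (E₁.bcBondConfig ω₁) c₀ n) ∈ E₂.bcBondConfig ω₂))
    (hin₁ : ∀ n < k, E₁.IsInnerFace (cFace (cornerOrbit (E₁.bcBondConfig ω₁) c₀ n)))
    (hin₂ : ∀ n < k, E₂.IsInnerFace (cFace (cornerOrbit (E₁.bcBondConfig ω₁) c₀ n))) :
    ∃ (c c' : Curve ℂ) (s : unitInterval), CurveClass.mk c = bondInterfaceIn D₁ E₁ ω₁ ∧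
      CurveClass.mk c' = bondInterfaceIn D₂ E₂ ω₂ ∧ (∀ t : unitInterval, t ≤ s → c t = c' t) ∧
      c s = medialPoint E₁.δ (cSrc (cornerOrbit (E₁.bcBondConfig ω₁) c₀ k)) := by
  obtain ⟨hagree, hend⟩ := medialExplorationCurve_eq_of_agree hE₁ hE₂ hδ hc₁ hc₂ hstat hin₁ hin₂
  refine ⟨⟨medialExplorationCurve E₁ ω₁⟩, ⟨medialExplorationCurve E₂ ω₂⟩,
    ⟨1 - (1 / 2) ^ k, one_sub_half_pow_mem_unitInterval k⟩, ?_, ?_, fun t ht => hagree t ht, hend⟩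
  · rw [bondInterfaceIn_apply, orientCurve_of_le]
    rwa [medialExplorationCurve_apply_zero hE₁ hc₁]
  · rw [bondInterfaceIn_apply, orientCurve_of_le]
    rwa [medialExplorationCurve_apply_zero hE₂ hc₂]

/-! ### First divergence -/

/-- **First divergence of two explorations from a common start corner.** For admissible data
`E₁`, `E₂` with a common start corner and configurations `ω₁`, `ω₂`: either the two medial
explorations are the same list, or there is a step `k` such that everything read before step
`k` agrees (statuses of the target edges, innerness of the faces, along the common orbit) and
at step `k` either both faces are inner and the status of the target edge `cTgt (orb k)`
differs, or exactly one of the two data has `cFace (orb k)` as an inner face.  In the second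
case the hypotheses of `medialExploration_take_eq` / `exists_commonPrefix_bondInterfaceIn` hold
at `k`. (Smirnov 2001, §2: the exploration reads only the edges adjacent to its past.) -/
theorem medialExploration_eq_or_diverge {E₁ E₂ : DiscreteDobrushin} (hE₁ : E₁.IsZdAdmissible)
    (hE₂ : E₂.IsZdAdmissible) {c₀ : Site 2 × Fin 4} (hc₁ : E₁.IsStartCorner c₀)
    (hc₂ : E₂.IsStartCorner c₀) (ω₁ ω₂ : BondConfig (Site 2)) :
    medialExploration E₁ ω₁ = medialExploration E₂ ω₂ ∨
      ∃ k, (∀ n < k, (cTgt (cornerOrbit (E₁.bcBondConfig ω₁) c₀ n) ∈ E₁.bcBondConfig ω₁ ↔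
          cTgt (cornerOrbit (E₁.bcBondConfig ω₁) c₀ n) ∈ E₂.bcBondConfig ω₂)) ∧
        (∀ n < k, E₁.IsInnerFace (cFace (cornerOrbit (E₁.bcBondConfig ω₁) c₀ n))) ∧
        (∀ n < k, E₂.IsInnerFace (cFace (cornerOrbit (E₁.bcBondConfig ω₁) c₀ n))) ∧
        ((E₁.IsInnerFace (cFace (cornerOrbit (E₁.bcBondConfig ω₁) c₀ k)) ∧
            E₂.IsInnerFace (cFace (cornerOrbit (E₁.bcBondConfig ω₁) c₀ k)) ∧
            ¬ (cTgt (cornerOrbit (E₁.bcBondConfig ω₁) c₀ k) ∈ E₁.bcBondConfig ω₁ ↔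
              cTgt (cornerOrbit (E₁.bcBondConfig ω₁) c₀ k) ∈ E₂.bcBondConfig ω₂)) ∨
          ¬ (E₁.IsInnerFace (cFace (cornerOrbit (E₁.bcBondConfig ω₁) c₀ k)) ↔
            E₂.IsInnerFace (cFace (cornerOrbit (E₁.bcBondConfig ω₁) c₀ k)))) := by
  classical
  set β₁ := E₁.bcBondConfig ω₁ with hβ₁
  set β₂ := E₂.bcBondConfig ω₂ with hβ₂
  -- the conjunction of the three readings at step `n`
  let P : ℕ → Prop := fun n => (cTgt (cornerOrbit β₁ c₀ n) ∈ β₁ ↔ cTgt (cornerOrbit β₁ c₀ n) ∈ β₂) ∧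
    E₁.IsInnerFace (cFace (cornerOrbit β₁ c₀ n)) ∧ E₂.IsInnerFace (cFace (cornerOrbit β₁ c₀ n))
  obtain ⟨N₁, hN₁, hlt₁, heq₁⟩ := exists_medialExploration_eq_explorationList hE₁ hc₁ ω₁
  have hex : ∃ n, ¬ P n := ⟨N₁, fun h => hN₁ h.2.1⟩
  set k := Nat.find hex with hk
  have hbefore : ∀ n < k, P n := fun n hn => not_not.1 (Nat.find_min hex hn)
  have hat : ¬ P k := Nat.find_spec hex
  have hstat : ∀ n < k, (cTgt (cornerOrbit β₁ c₀ n) ∈ β₁ ↔ cTgt (cornerOrbit β₁ c₀ n) ∈ β₂) :=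
    fun n hn => (hbefore n hn).1
  have hin₁ : ∀ n < k, E₁.IsInnerFace (cFace (cornerOrbit β₁ c₀ n)) := fun n hn => (hbefore n hn).2.1
  have hin₂ : ∀ n < k, E₂.IsInnerFace (cFace (cornerOrbit β₁ c₀ n)) := fun n hn => (hbefore n hn).2.2
  have horb := cornerOrbit_eq_of_agree β₁ β₂ c₀ hstat
  by_cases h₁ : E₁.IsInnerFace (cFace (cornerOrbit β₁ c₀ k))
  · by_cases h₂ : E₂.IsInnerFace (cFace (cornerOrbit β₁ c₀ k))
    · exact Or.inr ⟨k, hstat, hin₁, hin₂, Or.inl ⟨h₁, h₂, fun h => hat ⟨h, h₁, h₂⟩⟩⟩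
    · exact Or.inr ⟨k, hstat, hin₁, hin₂, Or.inr fun h => h₂ (h.1 h₁)⟩
  · by_cases h₂ : E₂.IsInnerFace (cFace (cornerOrbit β₁ c₀ k))
    · exact Or.inr ⟨k, hstat, hin₁, hin₂, Or.inr fun h => h₁ (h.2 h₂)⟩
    · -- both orbits exit at `k`: the two explorations are the same cut orbit
      left
      have hE₁k : medialExploration E₁ ω₁ = explorationList β₁ c₀ k :=
        (isMedialExploration_medialExploration_holds E₁ hE₁ ω₁).eq_explorationList hE₁ hc₁ h₁ hin₁
      have h₂' : ¬ E₂.IsInnerFace (cFace (cornerOrbit β₂ c₀ k)) := by rwa [← horb k le_rfl]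
      have hin₂' : ∀ n < k, E₂.IsInnerFace (cFace (cornerOrbit β₂ c₀ n)) := fun n hn => by
        rw [← horb n hn.le]; exact hin₂ n hn
      have hE₂k : medialExploration E₂ ω₂ = explorationList β₂ c₀ k :=
        (isMedialExploration_medialExploration_holds E₂ hE₂ ω₂).eq_explorationList hE₂ hc₂ h₂' hin₂'
      rw [hE₁k, hE₂k]
      exact explorationList_eq_of_cornerOrbit_eq β₁ β₂ c₀ c₀ horb

/-! ### Compatible data: equal interfaces or a common prefix ending at an incompatible vertex -/

/-- **Exact lattice locality, deterministic form.** Let `E₁`, `E₂` be admissible data with the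
same mesh and a common start corner `c₀` whose source midpoint is at least as close to `a` as to
`b` for both marked domains, and let `U` be a set of sites at which the two completed
configurations agree (the four edges at a site of `U` have the same status in
`E₁.bcBondConfig ω₁` and `E₂.bcBondConfig ω₂`, the four faces the same innerness).  Then either
the two interface classes coincide, or they have representatives agreeing on an initial parameter
interval `[0, s]` at the end of which they sit at the midpoint of the source edge of a corner
whose vertex is NOT in `U` (within half a mesh of that vertex, `dist_medialPoint_cSrc_le`).
For nested Dobrushin domains with compatible discretisations, `U` = sites farther than `ρ'`
from `closure (D ∖ D')` gives the disjunct of `stub_discreteLocality`. (Smirnov 2001, §2.) -/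
theorem bondInterfaceIn_eq_or_commonPrefix (D₁ D₂ : DobrushinDomain) {E₁ E₂ : DiscreteDobrushin}
    (hE₁ : E₁.IsZdAdmissible) (hE₂ : E₂.IsZdAdmissible) (hδ : E₁.δ = E₂.δ)
    {c₀ : Site 2 × Fin 4} (hc₁ : E₁.IsStartCorner c₀) (hc₂ : E₂.IsStartCorner c₀)
    (ho₁ : dist (medialPoint E₁.δ (cSrc c₀)) (D₁.pt 0) ≤ dist (medialPoint E₁.δ (cSrc c₀)) (D₁.pt 1))
    (ho₂ : dist (medialPoint E₂.δ (cSrc c₀)) (D₂.pt 0) ≤ dist (medialPoint E₂.δ (cSrc c₀)) (D₂.pt 1))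
    (U : Set (Site 2)) {ω₁ ω₂ : BondConfig (Site 2)}
    (hU : ∀ p : Site 2 × Fin 4, p.1 ∈ U →
      ((cTgt p ∈ E₁.bcBondConfig ω₁ ↔ cTgt p ∈ E₂.bcBondConfig ω₂) ∧
        (E₁.IsInnerFace (cFace p) ↔ E₂.IsInnerFace (cFace p)))) :
    bondInterfaceIn D₁ E₁ ω₁ = bondInterfaceIn D₂ E₂ ω₂ ∨
      ∃ (c c' : Curve ℂ) (s : unitInterval) (p : Site 2 × Fin 4),
        CurveClass.mk c = bondInterfaceIn D₁ E₁ ω₁ ∧ CurveClass.mk c' = bondInterfaceIn D₂ E₂ ω₂ ∧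
        (∀ t : unitInterval, t ≤ s → c t = c' t) ∧ c s = medialPoint E₁.δ (cSrc p) ∧ p.1 ∉ U := by
  rcases medialExploration_eq_or_diverge hE₁ hE₂ hc₁ hc₂ ω₁ ω₂ with heq | ⟨k, hstat, hin₁, hin₂, hdiv⟩
  · left
    have hcurve : medialExplorationCurve E₁ ω₁ = medialExplorationCurve E₂ ω₂ := by
      rw [medialExplorationCurve, medialExplorationCurve, heq, hδ]
    rw [bondInterfaceIn_apply, bondInterfaceIn_apply, orientCurve_of_le, orientCurve_of_le, hcurve]
    · rwa [medialExplorationCurve_apply_zero hE₂ hc₂]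
    · rwa [medialExplorationCurve_apply_zero hE₁ hc₁]
  · right
    obtain ⟨c, c', s, h1, h2, h3, h4⟩ :=
      exists_commonPrefix_bondInterfaceIn D₁ D₂ hE₁ hE₂ hδ hc₁ hc₂ ho₁ ho₂ hstat hin₁ hin₂
    refine ⟨c, c', s, cornerOrbit (E₁.bcBondConfig ω₁) c₀ k, h1, h2, h3, h4, fun hmem => ?_⟩
    obtain ⟨hs, hf⟩ := hU _ hmem
    rcases hdiv with ⟨-, -, h⟩ | h
    · exact h hs
    · exact h hf

/-- **Registered sub-goal stub `stub_discreteLocality_explorationPrefix`** of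
`stub_discreteLocality` (crux `LagHandOff`, line `crosscut-dictionary`): the deterministic
exploration-prefix groundwork `bondInterfaceIn_eq_or_commonPrefix`, fully quantified. -/
theorem stub_discreteLocality_explorationPrefix : ∀ (D₁ D₂ : DobrushinDomain) (E₁ E₂ : DiscreteDobrushin), E₁.IsZdAdmissible → E₂.IsZdAdmissible → E₁.δ = E₂.δ → ∀ c₀ : Site 2 × Fin 4, E₁.IsStartCorner c₀ → E₂.IsStartCorner c₀ → dist (medialPoint E₁.δ (cSrc c₀)) (D₁.pt 0) ≤ dist (medialPoint E₁.δ (cSrc c₀)) (D₁.pt 1) → dist (medialPoint E₂.δ (cSrc c₀)) (D₂.pt 0) ≤ dist (medialPoint E₂.δ (cSrc c₀)) (D₂.pt 1) → ∀ (U : Set (Site 2)) (ω₁ ω₂ : BondConfig (Site 2)), (∀ p : Site 2 × Fin 4, p.1 ∈ U → ((cTgt p ∈ E₁.bcBondConfig ω₁ ↔ cTgt p ∈ E₂.bcBondConfig ω₂) ∧ (E₁.IsInnerFace (cFace p) ↔ E₂.IsInnerFace (cFace p)))) → bondInterfaceIn D₁ E₁ ω₁ = bondInterfaceIn D₂ E₂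 ω₂ ∨ ∃ (c c' : Curve ℂ) (s : unitInterval) (p : Site 2 × Fin 4), CurveClass.mk c = bondInterfaceIn D₁ E₁ ω₁ ∧ CurveClass.mk c' = bondInterfaceIn D₂ E₂ ω₂ ∧ (∀ t : unitInterval, t ≤ s → c t = c' t) ∧ c s = medialPoint E₁.δ (cSrc p) ∧ p.1 ∉ U :=
  fun D₁ D₂ _ _ hE₁ hE₂ hδ _ hc₁ hc₂ ho₁ ho₂ U _ _ hU =>
    bondInterfaceIn_eq_or_commonPrefix D₁ D₂ hE₁ hE₂ hδ hc₁ hc₂ ho₁ ho₂ U hU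

end Summit.CriticalPhenomena.CardyFormulaZ2.Cruxes.LagHandOff.CrosscutDictionary

end
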